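/-
Copyright (c) 2026 the pub-hodgecm-mathlib formalisation cell (harness21).  Prover seat hodgecm-mathlib-K2E1-p08 (g3), Track B ∕ K2-LIT
(build stream 29), h413 = `stmt-HodgeConjecture-24833`, line `K2_E1_TraceFormulaBeta`, row 10∕13 (DEAL F ∕ G2b: `R(ε)R(φ̃)R(ε)⁻¹ = R(φ̃ ∘ ε)`);
dealer K2E1-plan (g2) RULINGS «G1 GO then G2 GO» 2026-09-04T01:27:06Z, «G1c∕G2 continue» 02:02:50Z.  2026-09-04.
-/
import Summits.HodgeConjecture.HodgeConjecture.Theorems.K2E1TwistQuotientDefs   -- ★ p856744 (K2E1-p08 g3): `twistGl`, `twistMulEquiv`, `twistL2`, `twistL2_rightRegular`, `twistL2_twistL2`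
import Literature.NumberTheory.Automorphic.IntegratedOperator      -- ★ `ContRepresentation.integratedOperator`, `integratedOperator_apply`, `integrable_smul_apply`
import Literature.MeasureTheory.Group.HaarAutomorphismInnerSquare    -- ★ `measurePreserving_of_map_map_eq_self` (an automorphism whose square preserves Haar measure preserves it)
import HarnessLib

/-!
# h413 ∕ Track B «K2-LIT», line `K2_E1_TraceFormulaBeta`, row 10∕13 (G2b) — **`R(ε) R(f) R(ε)⁻¹ = R(f ∘ ε)`**: the unitary twist `R(ε) = twistL2` conjugates the integrated
# operator `R(f)` of the regular representation of `GL_n(𝔸_E)` on `L²([G̃])` into `R(f ∘ ε)`; with the generic engine (integrated operators under a CONJUGATE-EQUIVARIANT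
# intertwiner) and the `ε`-invariance of every Haar measure on `GL_n(𝔸_E)`

Cell `pub/hodgecm-mathlib`, crux H413 = `stmt-HodgeConjecture-24833`, route of record `HCCMUnconditional`; chair K2-lead (g0), dealer K2E1-plan (g2) (DEAL F survey
`K2/K2E1-p08/g3/MEMO-DEALF-row10-survey.K2E1-p08-g3.md` item G2 «`R(ε)R(φ̃)R(ε)⁻¹ = R(φ̃∘ε)`»).  THEOREMS ONLY (no `def`, no structure, no instance, no `sorry`); lane
`--kind proof --supports stmt-HodgeConjecture-24833 --as helper`.  This is the operator identity behind the `ε`-twisted trace `Tr(π̃(φ̃)π̃(ε))` of Rogawski's comparison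
[Rogawski1990 §2.1 p. 12 «`(ρ(ε)φ)(g) = φ(ε⁻¹(g))`»; §13.5 p. 207 «`π` … contributes `Tr(π(φ)π(ε))`»] for the unitary `R(ε) = twistL2` of ★ `K2E1TwistQuotientDefs` (p856744).
* §1 (generic) **`map_integratedOperator_of_conj_intertwining`** — unitary strongly continuous `π` on `E`, `π'` on `E'`, bounded `T : E → E'` with `T (π(g) x) = π'(θ g) (T x)`, a
  self-map `θ` of `G` PRESERVING `η` and a measurable embedding, `f, F ∈ C_c(G)` with `F (θ x) = f x` (`F = f ∘ θ⁻¹`): **`T (π(f) v) = π'(F) (T v)`**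
  (`T ∫ f(g) π(g)v dη = ∫ f(g) π'(θg) Tv dη(g) = ∫ F(y) π'(y) Tv d(θ_*η)(y)`; `θ = 1` is ★ `map_integratedOperator_of_intertwining`); operator form `comp_integratedOperator_of_conj_intertwining`.
* §2 (generic) **`measurePreserving_of_involutive_continuousMulEquiv`** — a continuous INVOLUTIVE automorphism `e` of a second countable locally compact group preserves every Haar
  measure: `e_* e_* μ = μ` trivially, so ★ `Literature.MeasureTheory.Group.measurePreserving_of_map_map_eq_self` (module `c`, `c² = 1`) gives `e_* μ = μ` [Bourbaki INT VII §1
  no. 4; Folland Thm. 2.20]; `integral_comp_of_involutive_continuousMulEquiv`.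
* §3 (`G̃ = Res GL_n`, `ε = twistGl F Φ c`, `c² = 1`, `Φ` `c`-hermitian) **`measurePreserving_twistGl`** — EVERY Haar measure on `GL_n(𝔸_E)` is `ε`-invariant;
  `exists_testFunction_comp_twistGl` (`f ∘ ε ∈ C_c`); **`twistL2_integratedOperator`: `R(ε) (R(f) v) = R(f ∘ ε) (R(ε) v)`** for any `ε`-invariant `η` finite on compacts and
  `twistL2_integratedOperator_haar` for Haar `η`; **`twistL2_integratedOperator_twistL2`: `R(ε) R(f) R(ε) = R(f ∘ ε)`** (`R(ε)⁻¹ = R(ε)`), `integratedOperator_twistL2`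
  (`R(f) R(ε) = R(ε) R(f ∘ ε)`).  Here `R(f) = ((gl n E).rightRegular ν).integratedOperator (isUnitary_rightRegular ν) hsc η f` (★ `IntegratedOperator`), `hsc` its strong
  continuity (★ `isStronglyContinuous_rightRegular_holds` downstream), `ν` any automorphic measure on `[G̃]`.

HONEST LABEL.  Helper theorems; close no socket; HC_CM is proved only modulo the 7 printed citations (2 remaining named inputs: hLiu418 = `stmt-HodgeConjecture-24832`, h413 =
`stmt-HodgeConjecture-24833`) until rung 0 closes.  NOT here (G3, XL of record): the twisted traces `Tr(π̃(φ̃)π̃(ε))` on `ε`-stable discrete classes and their absolute convergence.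

## References
* [Rogawski1990] J. D. Rogawski, *Automorphic Representations of Unitary Groups in Three Variables* (1990), §2.1 p. 12, §13.5 p. 207.
* [DeitmarEchterhoff2014] A. Deitmar, S. Echterhoff, *Principles of Harmonic Analysis*, 2nd ed. (2014), Lemma 1.6.3, Prop. 6.2.1, Lemma 9.2.7.
* [BourbakiINT7] N. Bourbaki, *Intégration*, Ch. VII §1 no. 4 (behaviour of Haar measure under automorphisms: the modulus).
* [Folland1995] G. B. Folland, *A Course in Abstract Harmonic Analysis* (1995), Thm. 2.20.
-/

set_option autoImplicit false
-- the mandated namespace repeats `HodgeConjecture.HodgeConjecture`, as in every `Theorems/*.lean` of this sub-problem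
set_option linter.dupNamespace false

noncomputable section

open MeasureTheory Measure Set Filter Topology Function TopologicalSpace CompactlySupported
open scoped NNReal ENNReal

namespace Summit.HodgeConjecture.HodgeConjecture.Cruxes.H413.K2E1TwistIntegratedOperator

open Literature.NumberTheory.Automorphic

/-! ## §1 Integrated operators under a conjugate-equivariant intertwiner -/

section ConjIntertwining

variable {G E E' : Type*} [Group G] [TopologicalSpace G] [MeasurableSpace G] [OpensMeasurableSpace G]
  [NormedAddCommGroup E] [InnerProductSpace ℂ E] [CompleteSpace E]
  [NormedAddCommGroup E'] [InnerProductSpace ℂ E'] [CompleteSpace E']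
  {π : ContRepresentation ℂ G E} {π' : ContRepresentation ℂ G E'}

/-- **Integrated operators under a CONJUGATE-EQUIVARIANT intertwiner.**  Let `π`, `π'` be unitary strongly continuous representations of `G` on Hilbert spaces `E`, `E'`, `T : E →L E'`
bounded with `T (π(g) x) = π'(θ g) (T x)` for a self-map `θ` of `G` preserving the measure `η` (finite on compacts) and a measurable embedding, and let `f, F ∈ C_c(G)` with
`F (θ x) = f x`.  Then **`T (π(f) v) = π'(F) (T v)`**: `T ∫ f(g) • π(g) v dη(g) = ∫ f(g) • π'(θ g)(T v) dη(g) = ∫ F(θ g) • π'(θ g)(T v) dη(g) = ∫ F(y) • π'(y)(T v) dη(y)`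
(Bochner integrals commute with bounded operators; change of variables along the measure-preserving `θ`).  For `θ = id` this is ★ `map_integratedOperator_of_intertwining`.
[cite: DeitmarEchterhoff2014, Lemma 9.2.7; Lemma 1.6.3] -/
theorem map_integratedOperator_of_conj_intertwining (hu : π.IsUnitary) (hc : π.IsStronglyContinuous) (hu' : π'.IsUnitary) (hc' : π'.IsStronglyContinuous)
    (η : Measure G) [IsFiniteMeasureOnCompacts η] {θ : G → G} (hθ : MeasurePreserving θ η η) (hθe : MeasurableEmbedding θ)
    (T : E →L[ℂ] E') (hT : ∀ (g : G) (x : E), T (π g x) = π' (θ g) (T x)) (f F : C_c(G, ℂ)) (hF : ∀ x, F (θ x) = f x) (v : E) :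
    T (π.integratedOperator hu hc η f v) = π'.integratedOperator hu' hc' η F (T v) := by
  have h : ∫ x, F (θ x) • π' (θ x) (T v) ∂η = ∫ y, F y • π' y (T v) ∂η := hθ.integral_comp hθe (fun y => F y • π' y (T v))
  rw [ContRepresentation.integratedOperator_apply, ContRepresentation.integratedOperator_apply,
    ← ContinuousLinearMap.integral_comp_comm T (ContRepresentation.integrable_smul_apply hc η f v), ← h]
  refine integral_congr_ae (Eventually.of_forall fun g => ?_)
  change T (f g • π g v) = F (θ g) • π' (θ g) (T v)
  rw [ContinuousLinearMap.map_smul, hT, hF]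

/-- Operator form: **`T ∘ π(f) = π'(F) ∘ T`** under the hypotheses of `map_integratedOperator_of_conj_intertwining`. [cite: DeitmarEchterhoff2014, Lemma 9.2.7; Lemma 1.6.3] -/
theorem comp_integratedOperator_of_conj_intertwining (hu : π.IsUnitary) (hc : π.IsStronglyContinuous) (hu' : π'.IsUnitary) (hc' : π'.IsStronglyContinuous)
    (η : Measure G) [IsFiniteMeasureOnCompacts η] {θ : G → G} (hθ : MeasurePreserving θ η η) (hθe : MeasurableEmbedding θ)
    (T : E →L[ℂ] E') (hT : ∀ (g : G) (x : E), T (π g x) = π' (θ g) (T x)) (f F : C_c(G, ℂ)) (hF : ∀ x, F (θ x) = f x) :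
    T ∘L π.integratedOperator hu hc η f = π'.integratedOperator hu' hc' η F ∘L T :=
  ContinuousLinearMap.ext fun v => map_integratedOperator_of_conj_intertwining hu hc hu' hc' η hθ hθe T hT f F hF v

end ConjIntertwining

/-! ## §2 A continuous involutive automorphism preserves Haar measure -/

section Haar

variable {G : Type*} [Group G] [TopologicalSpace G] [IsTopologicalGroup G] [LocallyCompactSpace G] [SecondCountableTopology G] [MeasurableSpace G] [BorelSpace G]

/-- **A continuous involutive group automorphism preserves every Haar measure.**  For `e : G ≃ₜ* G` with `e ∘ e = id` on a second countable locally compact group and a Haar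
measure `μ`: `e_* e_* μ = (e ∘ e)_* μ = μ`, so `e_* μ = μ` by ★ `Literature.MeasureTheory.Group.measurePreserving_of_map_map_eq_self` («an automorphism whose square preserves
Haar measure preserves Haar measure»: `e_* μ = c • μ`, `c² = 1 ⟹ c = 1`; the module of an involution is `1`). [cite: BourbakiINT7, Ch. VII §1 no. 4] [cite: Folland1995, Thm. 2.20] -/
theorem measurePreserving_of_involutive_continuousMulEquiv (e : G ≃ₜ* G) (μ : Measure G) [μ.IsHaarMeasure] (he : Function.Involutive e) : MeasurePreserving e μ μ :=
  have hme : Measurable (e : G → G) := e.continuous.measurable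
  Literature.MeasureTheory.Group.measurePreserving_of_map_map_eq_self e μ (by rw [Measure.map_map hme hme, he.comp_self, Measure.map_id])

/-- **Change of variables along a continuous involutive automorphism**: `∫ F (e x) dμ = ∫ F dμ` for a Haar measure `μ` and every `F` (no measurability needed: `e` is a
measurable equivalence). [cite: BourbakiINT7, Ch. VII §1 no. 4] [cite: Folland1995, Thm. 2.20] -/
theorem integral_comp_of_involutive_continuousMulEquiv {V : Type*} [NormedAddCommGroup V] [NormedSpace ℝ V] (e : G ≃ₜ* G) (μ : Measure G) [μ.IsHaarMeasure]
    (he : Function.Involutive e) (F : G → V) : ∫ x, F (e x) ∂μ = ∫ x, F x ∂μ :=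
  (measurePreserving_of_involutive_continuousMulEquiv e μ he).integral_comp e.toHomeomorph.measurableEmbedding F

end Haar

/-! ## §3 `G̃ = Res_{E∕F} GL_n`: Haar measures are `ε`-invariant and `R(ε) R(f) R(ε)⁻¹ = R(f ∘ ε)` -/

section GLn

open NumberField Literature.NumberTheory.Automorphic.AdelicGroupData
open Summit.HodgeConjecture.HodgeConjecture.Cruxes.H413.K2E1TwistQuotientDefs
open scoped MatrixGroups Matrix

variable (F : Type) {E : Type} [Field F] [Field E] [NumberField E] [Algebra F E] {n : ℕ} (Φ : GL (Fin n) E) (c : E ≃ₐ[F] E)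
  (hc : c * c = 1) (hΦ : ((Φ : GL (Fin n) E) : Matrix (Fin n) (Fin n) E)ᵀ.map c = (Φ : Matrix (Fin n) (Fin n) E))
  [MeasurableSpace (gl n E).Adelic] [BorelSpace (gl n E).Adelic]

include hc hΦ

/-- **Every Haar measure on `GL_n(𝔸_E)` is `ε`-invariant** (`c² = 1`, `Φ` `c`-hermitian, so `ε ∘ ε = id`): §2 applied to `ε` as a continuous multiplicative equivalence
(★ `twistMulEquiv`, ★ `continuous_twistGl`) of the second countable locally compact group `GL_n(𝔸_E)` (★ `locallyCompactSpace_gl_adelic_holds`, ★ `secondCountableTopology_gl_adelic`).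
[cite: BourbakiINT7, Ch. VII §1 no. 4] [cite: Rogawski1990, §2.1 p. 12] -/
theorem measurePreserving_twistGl (η : Measure (gl n E).Adelic) [η.IsHaarMeasure] : MeasurePreserving (twistGl F Φ c) η η := by
  haveI : LocallyCompactSpace (gl n E).Adelic := locallyCompactSpace_gl_adelic_holds n E
  haveI : SecondCountableTopology (gl n E).Adelic := secondCountableTopology_gl_adelic n E
  let e : (gl n E).Adelic ≃ₜ* (gl n E).Adelic :=
    { twistMulEquiv F Φ c hc hΦ with continuous_toFun := continuous_twistGl F Φ c, continuous_invFun := continuous_twistGl F Φ c }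
  exact measurePreserving_of_involutive_continuousMulEquiv e η (twistGl_twistGl F Φ c hc hΦ)

/-- `∫ F (ε g) dη = ∫ F dη` for a Haar measure `η` on `GL_n(𝔸_E)` and every `F`. [cite: BourbakiINT7, Ch. VII §1 no. 4] -/
theorem integral_comp_twistGl {V : Type*} [NormedAddCommGroup V] [NormedSpace ℝ V] (η : Measure (gl n E).Adelic) [η.IsHaarMeasure] (Fn : (gl n E).Adelic → V) :
    ∫ g, Fn (twistGl F Φ c g) ∂η = ∫ g, Fn g ∂η :=
  (measurePreserving_twistGl F Φ c hc hΦ η).integral_comp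
    (Homeomorph.mk (twistMulEquiv F Φ c hc hΦ).toEquiv (continuous_twistGl F Φ c) (continuous_twistGl F Φ c)).measurableEmbedding Fn

omit [MeasurableSpace (gl n E).Adelic] [BorelSpace (gl n E).Adelic] in
/-- **`f ∘ ε` is again a test function**: for `f ∈ C_c(GL_n(𝔸_E))` there is `fε ∈ C_c(GL_n(𝔸_E))` with `fε = f ∘ ε` (composition with the homeomorphism `ε`, Mathlib
`CompactlySupportedContinuousMap.comp` along `Homeomorph.toCocompactMap`). [cite: Rogawski1990, §2.1 p. 12] -/
theorem exists_testFunction_comp_twistGl (f : C_c((gl n E).Adelic, ℂ)) : ∃ fε : C_c((gl n E).Adelic, ℂ), ∀ x, fε x = f (twistGl F Φ c x) :=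
  ⟨f.comp (Homeomorph.mk (twistMulEquiv F Φ c hc hΦ).toEquiv (continuous_twistGl F Φ c) (continuous_twistGl F Φ c)).toCocompactMap, fun _ => rfl⟩

variable (ν : Measure (gl n E).automorphicQuotient) [(gl n E).IsAutomorphicMeasure ν]

/-- **`R(ε) R(f) = R(f ∘ ε) R(ε)`** on `L²([G̃])`: for an `ε`-invariant measure `η` on `GL_n(𝔸_E)` finite on compacts (every Haar measure: `measurePreserving_twistGl`), the strong
continuity `hsc` of the regular representation, `f, fε ∈ C_c(GL_n(𝔸_E))` with `fε = f ∘ ε`, and `v ∈ L²(ν)`: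
`R(ε) (R(f) v) = R(fε) (R(ε) v)` — §1 with `T = R(ε)`, `θ = ε` (★ `twistL2_rightRegular`: `R(ε) R(g) = R(ε g) R(ε)`) and `fε (ε x) = f (ε ε x) = f x`.
[cite: Rogawski1990, §2.1 p. 12; §13.5 p. 207] [cite: DeitmarEchterhoff2014, Lemma 9.2.7] -/
theorem twistL2_integratedOperator (η : Measure (gl n E).Adelic) [IsFiniteMeasureOnCompacts η] (hη : MeasurePreserving (twistGl F Φ c) η η)
    (hsc : ((gl n E).rightRegular ν).IsStronglyContinuous) (f fε : C_c((gl n E).Adelic, ℂ)) (hfε : ∀ x, fε x = f (twistGl F Φ c x)) (v : (gl n E).L2 ν) :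
    twistL2 F Φ c ν hc hΦ (((gl n E).rightRegular ν).integratedOperator ((gl n E).isUnitary_rightRegular ν) hsc η f v) =
      ((gl n E).rightRegular ν).integratedOperator ((gl n E).isUnitary_rightRegular ν) hsc η fε (twistL2 F Φ c ν hc hΦ v) :=
  map_integratedOperator_of_conj_intertwining ((gl n E).isUnitary_rightRegular ν) hsc ((gl n E).isUnitary_rightRegular ν) hsc η hη
    (Homeomorph.mk (twistMulEquiv F Φ c hc hΦ).toEquiv (continuous_twistGl F Φ c) (continuous_twistGl F Φ c)).measurableEmbedding
    (twistL2 F Φ c ν hc hΦ).toContinuousLinearMap (twistL2_rightRegular F Φ c hc hΦ) f fε (fun x => by rw [hfε, twistGl_twistGl F Φ c hc hΦ]) v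

/-- The same for a HAAR measure `η` on `GL_n(𝔸_E)` (`ε`-invariance supplied by `measurePreserving_twistGl`). [cite: Rogawski1990, §2.1 p. 12; §13.5 p. 207] -/
theorem twistL2_integratedOperator_haar (η : Measure (gl n E).Adelic) [η.IsHaarMeasure] (hsc : ((gl n E).rightRegular ν).IsStronglyContinuous)
    (f fε : C_c((gl n E).Adelic, ℂ)) (hfε : ∀ x, fε x = f (twistGl F Φ c x)) (v : (gl n E).L2 ν) :
    twistL2 F Φ c ν hc hΦ (((gl n E).rightRegular ν).integratedOperator ((gl n E).isUnitary_rightRegular ν) hsc η f v) =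
      ((gl n E).rightRegular ν).integratedOperator ((gl n E).isUnitary_rightRegular ν) hsc η fε (twistL2 F Φ c ν hc hΦ v) :=
  twistL2_integratedOperator F Φ c hc hΦ ν η (measurePreserving_twistGl F Φ c hc hΦ η) hsc f fε hfε v

/-- **`R(ε) R(f) R(ε) = R(f ∘ ε)`**, i.e. `R(ε) R(f) R(ε)⁻¹ = R(f ∘ ε)` with `R(ε)⁻¹ = R(ε)` (★ `twistL2_twistL2`): the conjugation identity behind `Tr(π̃(φ̃)π̃(ε))`.
[cite: Rogawski1990, §2.1 p. 12; §13.5 p. 207] -/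
theorem twistL2_integratedOperator_twistL2 (η : Measure (gl n E).Adelic) [IsFiniteMeasureOnCompacts η] (hη : MeasurePreserving (twistGl F Φ c) η η)
    (hsc : ((gl n E).rightRegular ν).IsStronglyContinuous) (f fε : C_c((gl n E).Adelic, ℂ)) (hfε : ∀ x, fε x = f (twistGl F Φ c x)) (w : (gl n E).L2 ν) :
    twistL2 F Φ c ν hc hΦ (((gl n E).rightRegular ν).integratedOperator ((gl n E).isUnitary_rightRegular ν) hsc η f (twistL2 F Φ c ν hc hΦ w)) =
      ((gl n E).rightRegular ν).integratedOperator ((gl n E).isUnitary_rightRegular ν) hsc η fε w := by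
  rw [twistL2_integratedOperator F Φ c hc hΦ ν η hη hsc f fε hfε, twistL2_twistL2]

/-- **`R(f) R(ε) = R(ε) R(f ∘ ε)`** (apply `R(ε)` to `twistL2_integratedOperator_twistL2`). [cite: Rogawski1990, §2.1 p. 12; §13.5 p. 207] -/
theorem integratedOperator_twistL2 (η : Measure (gl n E).Adelic) [IsFiniteMeasureOnCompacts η] (hη : MeasurePreserving (twistGl F Φ c) η η)
    (hsc : ((gl n E).rightRegular ν).IsStronglyContinuous) (f fε : C_c((gl n E).Adelic, ℂ)) (hfε : ∀ x, fε x = f (twistGl F Φ c x)) (w : (gl n E).L2 ν) :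
    ((gl n E).rightRegular ν).integratedOperator ((gl n E).isUnitary_rightRegular ν) hsc η f (twistL2 F Φ c ν hc hΦ w) =
      twistL2 F Φ c ν hc hΦ (((gl n E).rightRegular ν).integratedOperator ((gl n E).isUnitary_rightRegular ν) hsc η fε w) := by
  rw [← twistL2_integratedOperator_twistL2 F Φ c hc hΦ ν η hη hsc f fε hfε w, twistL2_twistL2]

end GLn

end Summit.HodgeConjecture.HodgeConjecture.Cruxes.H413.K2E1TwistIntegratedOperator

end
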